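import Literature.Analysis.FluidPDE.BeiraoDaVeigaEnstrophyGronwall
import Literature.Analysis.FluidPDE.VorticityStretching
import Literature.Analysis.FluidPDE.LocalBiotSavartCalculus
import Literature.Analysis.FluidPDE.AxisymOmegaEnergy
import Literature.Analysis.FluidPDE.AxisymQuotientEquationsJ
import Literature.Analysis.FluidPDE.AxisymQuotientRayAverage
import HarnessLib

/-!
# One-component regularity: the balance of the third vorticity component (Lemarié-Rieusset 2016, §11.5, proof of Prop. 11.5, (11.27))

Analysis/FluidPDE proof file (theorems only: no definition, no named fact, no `sorry`).
Search for candidate a priori estimates; no regularity claim (cell `pub-nsfunc`, literature seat: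
this file formalises a PUBLISHED computation; nothing new). First brick of the discharge of the
named fact `Literature.Analysis.FluidPDE.oneComponentGradientCriterion`
(`GradientRegularityCriteria.lean`; P. G. Lemarié-Rieusset, *The Navier–Stokes Problem in the
21st Century* (2016), §11.5 Prop. 11.5, PDF pp. 354–357; J. Neustupa, A. Novotný, P. Penel 2002;
C. He 2002; M. Pokorný 2003; Y. Zhou 2002/2005).

The proof of Prop. 11.5 runs a Grönwall argument on `K = ½‖∇u‖₂² + λ(1 + ‖ω₃‖₂⁴/4)`,
`ω = curl u`. This file supplies the production identity of the auxiliary functional, i.e. the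
time derivative of `‖ω₃‖₂²` along a classical solution at a fixed time (LR (11.27)):
"`d/dt J = ‖ω₃‖₂² ∫ ω₃ ∂ₜω₃ = -ν‖ω₃‖₂² ∫|∇ω₃|² + … - ‖ω₃‖₂² ∫ ω₃ u·∇ω₃ + ‖ω₃‖₂² ∫ ω₃ ω·∇u₃`",
"As `div u = 0`, we have `∫ ω₃ u·∇ω₃ = 0`". With `∂ₜω = νΔω - (u·∇)ω + (ω·∇)u` (the vorticity
equation of the tree, `IsClassicalNSSolutionOn.curl_timeDerivWithin_eq`) taken as the hypothesis
on the field `W = ∂ₜu`, for a fixed time slice `v = u(t)` (indices `0, 1, 2` in Lean, so `ω₃` is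
`curl v · 2` and `u₃` is `v · 2`):

* `integral_curl_two_mul_laplacian_curl_two` — `∫ ω₃ (Δω)₃ = -∫ |∇ω₃|²`;
* `integral_curl_two_mul_convect_curl_two_eq_zero` — `∫ ω₃ ((v·∇)ω)₃ = 0` (`div v = 0`);
* `integral_curl_two_mul_curl_two_le` — the production inequality
  `∫ ω₃ (curl W)₃ ≤ -ν ∫|∇ω₃|² + ∫ |ω₃| |ω| |∇v₃|`
  (the stretching term `((ω·∇)v)₃ = ∇v₃ · ω` is bounded pointwise).

All in the `L²`-Sobolev class of a slice of Tao's smooth `H¹` theory (`v, Dv` bounded,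
`Dv, D²v, D³v, DW ∈ L²`), the setting of the tree's enstrophy files
(`SerrinEnstrophyGronwall`, `BeiraoDaVeigaEnstrophyGronwall`).

## References

* [LemarieRieusset2016] P. G. Lemarié-Rieusset, *The Navier–Stokes Problem in the 21st Century*,
  CRC Press 2016, §11.5, proof of Prop. 11.5, (11.27)–(11.28) (held text, PDF p. 355).
* [MajdaBertozziCUP2002] A. J. Majda, A. L. Bertozzi, *Vorticity and Incompressible Flow*, CUP
  2002, §1.1 (vorticity equation (1.33)).
-/

noncomputable section

open MeasureTheory Set Function Filter Topology InnerProductSpace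
open Literature.Analysis.FunctionSpaces
open scoped ENNReal NNReal ContDiff RealInnerProductSpace Laplacian

namespace Literature.Analysis.FluidPDE

/-! ### Tools -/

section Tools

/-- `L²`-membership of a continuous function with `∫⁻ ‖f‖ₑ² < ∞`. [folklore] -/
private theorem memLp_two_of_continuous_of_lintegral_lt_top {F : Type*} [NormedAddCommGroup F]
    {f : (EuclideanSpace ℝ (Fin 3)) → F} (hf : Continuous f) (h2 : ∫⁻ x, ‖f x‖ₑ ^ 2 < ⊤) : MemLp f 2 volume :=
  (memLp_two_iff_integrable_sq_norm hf.aestronglyMeasurable).2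
    (FluidPDE.integrable_sq_norm_of_lintegral_lt_top hf h2)

/-- The norm of the derivative of a component is at most the norm of the derivative. [folklore] -/
private theorem norm_fderiv_apply_coord_le {w : (EuclideanSpace ℝ (Fin 3)) → (EuclideanSpace ℝ (Fin 3))} {x : (EuclideanSpace ℝ (Fin 3))} (hw : DifferentiableAt ℝ w x) (i : Fin 3) :
    ‖fderiv ℝ (fun y => w y i) x‖ ≤ ‖fderiv ℝ w x‖ := by
  refine ContinuousLinearMap.opNorm_le_bound _ (norm_nonneg _) fun h => ?_
  rw [fderiv_apply_coord hw h i]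
  exact (PiLp.norm_apply_le (fderiv ℝ w x h) i).trans ((fderiv ℝ w x).le_opNorm h)

end Tools

/-! ### Bounds on `ω₃ = (curl v)₃` and its derivatives -/

section OmegaThree

variable {v : (EuclideanSpace ℝ (Fin 3)) → (EuclideanSpace ℝ (Fin 3))}

/-- From `‖a‖ ≤ c ‖b‖` with `c ≥ 0` to `‖a‖ ≤ ‖c • b‖`. [folklore] -/
private theorem norm_le_norm_smul_of_le_mul {F G : Type*} [NormedAddCommGroup F] [NormedAddCommGroup G]
    [NormedSpace ℝ G] {c : ℝ} (hc : 0 ≤ c) {a : F} {b : G} (h : ‖a‖ ≤ c * ‖b‖) : ‖a‖ ≤ ‖c • b‖ := by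
  rwa [norm_smul, Real.norm_of_nonneg hc]

/-- `|ω₃(x)| ≤ κ ‖Dv(x)‖` with `κ = ‖curlCLM‖` (in the `iteratedFDeriv` normalisation). [folklore] -/
private theorem norm_curl_two_le_mul (hv : ContDiff ℝ 1 v) (x : (EuclideanSpace ℝ (Fin 3))) :
    ‖curl v x 2‖ ≤ ‖(curlCLM : ((EuclideanSpace ℝ (Fin 3)) →L[ℝ] (EuclideanSpace ℝ (Fin 3))) →L[ℝ] (EuclideanSpace ℝ (Fin 3)))‖ * ‖iteratedFDeriv ℝ 1 v x‖ := by
  have h := norm_iteratedFDeriv_curl_apply_two_le (n := 0) (u := v) (by exact_mod_cast hv) x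
  rw [norm_iteratedFDeriv_zero] at h
  simpa using h

/-- `‖D(ω₃)(x)‖ ≤ κ ‖D²v(x)‖`. [folklore] -/
private theorem norm_fderiv_curl_two_le_mul (hv : ContDiff ℝ 2 v) (x : (EuclideanSpace ℝ (Fin 3))) :
    ‖fderiv ℝ (fun y => curl v y 2) x‖ ≤
      ‖(curlCLM : ((EuclideanSpace ℝ (Fin 3)) →L[ℝ] (EuclideanSpace ℝ (Fin 3))) →L[ℝ] (EuclideanSpace ℝ (Fin 3)))‖ * ‖iteratedFDeriv ℝ 2 v x‖ := by
  have h := norm_iteratedFDeriv_curl_apply_two_le (n := 1) (u := v) (by exact_mod_cast hv) x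
  rw [← norm_iteratedFDeriv_fderiv, norm_iteratedFDeriv_zero] at h
  simpa using h

/-- `‖D²(ω₃)(x)‖ ≤ κ ‖D³v(x)‖`. [folklore] -/
private theorem norm_iteratedFDeriv_two_curl_two_le_mul (hv : ContDiff ℝ 3 v) (x : (EuclideanSpace ℝ (Fin 3))) :
    ‖iteratedFDeriv ℝ 2 (fun y => curl v y 2) x‖ ≤
      ‖(curlCLM : ((EuclideanSpace ℝ (Fin 3)) →L[ℝ] (EuclideanSpace ℝ (Fin 3))) →L[ℝ] (EuclideanSpace ℝ (Fin 3)))‖ * ‖iteratedFDeriv ℝ 3 v x‖ := by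
  have h := norm_iteratedFDeriv_curl_apply_two_le (n := 2) (u := v) (by exact_mod_cast hv) x
  simpa using h

/-- `‖ω(x)‖ ≤ κ ‖Dv(x)‖`. [folklore] -/
private theorem norm_curl_le_mul (v : (EuclideanSpace ℝ (Fin 3)) → (EuclideanSpace ℝ (Fin 3))) (x : (EuclideanSpace ℝ (Fin 3))) :
    ‖curl v x‖ ≤ ‖(curlCLM : ((EuclideanSpace ℝ (Fin 3)) →L[ℝ] (EuclideanSpace ℝ (Fin 3))) →L[ℝ] (EuclideanSpace ℝ (Fin 3)))‖ * ‖iteratedFDeriv ℝ 1 v x‖ := by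
  rw [← norm_iteratedFDeriv_fderiv, norm_iteratedFDeriv_zero]
  exact norm_curl_le v x

/-- `‖Dω(x)‖ ≤ κ ‖D²v(x)‖`. [folklore] -/
private theorem norm_fderiv_curl_le_mul (hv : ContDiff ℝ 2 v) (x : (EuclideanSpace ℝ (Fin 3))) :
    ‖fderiv ℝ (curl v) x‖ ≤ ‖(curlCLM : ((EuclideanSpace ℝ (Fin 3)) →L[ℝ] (EuclideanSpace ℝ (Fin 3))) →L[ℝ] (EuclideanSpace ℝ (Fin 3)))‖ * ‖iteratedFDeriv ℝ 2 v x‖ := by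
  have h := norm_iteratedFDeriv_curl_le (n := 1) (w := v) (by exact_mod_cast hv) x
  rw [← norm_iteratedFDeriv_fderiv, norm_iteratedFDeriv_zero] at h
  simpa using h

end OmegaThree

/-! ### The viscous term: `∫ ω₃ (Δω)₃ = -∫ |∇ω₃|²` -/

section Viscous

/-- **`∫ ω₃ (Δω)₃ = -∫ |∇ω₃|²`** for `ω = curl v`, `v ∈ C³(ℝ³; ℝ³)` with `Dv, D²v, D³v ∈ L²`
(Lemarié-Rieusset 2016, (11.27), the term `-ν‖ω₃‖₂² ∫|∇ω₃|²`): `(Δω)₃ = Δ(ω₃)`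
(`laplacian_apply_coord_vec3`) and Green's identity for the decaying scalar `ω₃`
(`integral_mul_laplacian_eq_neg`). [cite: LemarieRieusset2016, §11.5 Prop. 11.5 proof, (11.27) (PDF p. 355)] -/
theorem integral_curl_two_mul_laplacian_curl_two {v : (EuclideanSpace ℝ (Fin 3)) → (EuclideanSpace ℝ (Fin 3))} (hv : ContDiff ℝ 3 v)
    (hv1 : ∫⁻ x, ‖iteratedFDeriv ℝ 1 v x‖ₑ ^ 2 < ⊤) (hv2 : ∫⁻ x, ‖iteratedFDeriv ℝ 2 v x‖ₑ ^ 2 < ⊤)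
    (hv3 : ∫⁻ x, ‖iteratedFDeriv ℝ 3 v x‖ₑ ^ 2 < ⊤) :
    ∫ x, curl v x 2 * (Δ (curl v)) x 2 =
      -∫ x, ∑ i, fderiv ℝ (fun y => curl v y 2) x (EuclideanSpace.basisFun (Fin 3) ℝ i) ^ 2 := by
  set κ : ℝ := ‖(curlCLM : ((EuclideanSpace ℝ (Fin 3)) →L[ℝ] (EuclideanSpace ℝ (Fin 3))) →L[ℝ] (EuclideanSpace ℝ (Fin 3)))‖ with hκ
  have hκ0 : 0 ≤ κ := norm_nonneg (curlCLM : ((EuclideanSpace ℝ (Fin 3)) →L[ℝ] (EuclideanSpace ℝ (Fin 3))) →L[ℝ] (EuclideanSpace ℝ (Fin 3)))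
  set g : (EuclideanSpace ℝ (Fin 3)) → ℝ := fun y => curl v y 2 with hg
  have hc2 : ContDiff ℝ 2 (curl v) := contDiff_curl (n := 2) (by exact_mod_cast hv)
  have hg2 : ContDiff ℝ 2 g := contDiff_apply_coord hc2 2
  have hg1 : ContDiff ℝ 1 g := hg2.of_le (by norm_num)
  have hΔ : ∀ x, (Δ (curl v)) x 2 = (Δ g) x := fun x => laplacian_apply_coord_vec3 hc2 x 2
  simp_rw [hΔ]
  have he : ∀ i : Fin 3, EuclideanSpace.basisFun (Fin 3) ℝ i = EuclideanSpace.single i (1 : ℝ) :=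
    fun i => by simp
  -- continuity
  have cg : Continuous g := hg2.continuous
  have cDg : Continuous (fderiv ℝ g) := hg2.continuous_fderiv (by norm_num)
  have cdg : ∀ i : Fin 3, Continuous fun x => fderiv ℝ g x (EuclideanSpace.single i (1 : ℝ)) :=
    fun i => cDg.clm_apply continuous_const
  have cddg : ∀ i : Fin 3, Continuous fun x =>
      fderiv ℝ (fun y => fderiv ℝ g y (EuclideanSpace.single i (1 : ℝ))) x (EuclideanSpace.single i 1) :=
    fun i => (((hg2.fderiv_right (m := 1) (by norm_num)).clm_apply contDiff_const).continuous_fderiv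
      (by norm_num)).clm_apply continuous_const
  -- pointwise bounds
  have n0 : ∀ x, ‖g x‖ ≤ ‖κ • iteratedFDeriv ℝ 1 v x‖ := fun x =>
    norm_le_norm_smul_of_le_mul hκ0 (norm_curl_two_le_mul (hv.of_le (by norm_num)) x)
  have n1 : ∀ i : Fin 3, ∀ x, ‖fderiv ℝ g x (EuclideanSpace.single i (1 : ℝ))‖ ≤
      ‖κ • iteratedFDeriv ℝ 2 v x‖ := fun i x => by
    have h1 : ‖fderiv ℝ g x (EuclideanSpace.single i (1 : ℝ))‖ ≤ ‖fderiv ℝ g x‖ := by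
      simpa using (fderiv ℝ g x).le_opNorm (EuclideanSpace.single i (1 : ℝ))
    exact norm_le_norm_smul_of_le_mul hκ0
      (h1.trans (norm_fderiv_curl_two_le_mul (hv.of_le (by norm_num)) x))
  have n2 : ∀ i : Fin 3, ∀ x, ‖fderiv ℝ (fun y => fderiv ℝ g y (EuclideanSpace.single i (1 : ℝ))) x
      (EuclideanSpace.single i 1)‖ ≤ ‖κ • iteratedFDeriv ℝ 3 v x‖ := fun i x => by
    have h1 := norm_fderiv_fderiv_apply_basisFun_le hg2 x i
    rw [he i] at h1
    exact norm_le_norm_smul_of_le_mul hκ0 (h1.trans (norm_iteratedFDeriv_two_curl_two_le_mul hv x))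
  -- `L²` memberships
  have h0 : MemLp g 2 volume := memLp_two_of_continuous_of_lintegral_lt_top cg
    (lintegral_enorm_sq_lt_top_of_norm_le n0 (lintegral_enorm_sq_const_smul_lt_top κ hv1))
  have h1 : ∀ i : Fin 3, MemLp (fun x => fderiv ℝ g x (EuclideanSpace.single i 1)) 2 volume :=
    fun i => memLp_two_of_continuous_of_lintegral_lt_top (cdg i)
      (lintegral_enorm_sq_lt_top_of_norm_le (n1 i) (lintegral_enorm_sq_const_smul_lt_top κ hv2))
  have h2 : ∀ i : Fin 3, MemLp (fun x => fderiv ℝ (fun y => fderiv ℝ g y (EuclideanSpace.single i 1)) x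
      (EuclideanSpace.single i 1)) 2 volume :=
    fun i => memLp_two_of_continuous_of_lintegral_lt_top (cddg i)
      (lintegral_enorm_sq_lt_top_of_norm_le (n2 i) (lintegral_enorm_sq_const_smul_lt_top κ hv3))
  rw [integral_mul_laplacian_eq_neg hg2 h0 h1 h2]
  congr 1
  refine integral_congr_ae (Eventually.of_forall fun x => ?_)
  simp only [Fin.sum_univ_three, he]

end Viscous

/-! ### The transport term: `∫ ω₃ ((v·∇)ω)₃ = 0` -/

section Transport

/-- **`∫ ω₃ ((v·∇)ω)₃ = 0`** for `ω = curl v`, `v ∈ C³(ℝ³; ℝ³)` bounded and divergence free with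
`Dv, D²v ∈ L²` (Lemarié-Rieusset 2016, proof of Prop. 11.5: "As `div u = 0`, we have
`∫ ω₃ u·∇ω₃ dx = 0`"): the tree's transport identity `∫⟪(c·∇)Z, Z⟫ = 0`
(`integral_inner_convect_transport_eq_zero`) for the field `Z = ω₃ e₃`.
[cite: LemarieRieusset2016, §11.5 Prop. 11.5 proof, (11.27) (PDF p. 355)] -/
theorem integral_curl_two_mul_convect_curl_two_eq_zero {v : (EuclideanSpace ℝ (Fin 3)) → (EuclideanSpace ℝ (Fin 3))} (hv : ContDiff ℝ 3 v)
    (hdiv : VectorCalculus.IsDivFree v) {B : ℝ} (hB : ∀ x, ‖v x‖ ≤ B)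
    (hv1 : ∫⁻ x, ‖iteratedFDeriv ℝ 1 v x‖ₑ ^ 2 < ⊤) (hv2 : ∫⁻ x, ‖iteratedFDeriv ℝ 2 v x‖ₑ ^ 2 < ⊤) :
    ∫ x, curl v x 2 * convect v (curl v) x 2 = 0 := by
  set κ : ℝ := ‖(curlCLM : ((EuclideanSpace ℝ (Fin 3)) →L[ℝ] (EuclideanSpace ℝ (Fin 3))) →L[ℝ] (EuclideanSpace ℝ (Fin 3)))‖ with hκ
  have hκ0 : 0 ≤ κ := norm_nonneg (curlCLM : ((EuclideanSpace ℝ (Fin 3)) →L[ℝ] (EuclideanSpace ℝ (Fin 3))) →L[ℝ] (EuclideanSpace ℝ (Fin 3)))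
  set g : (EuclideanSpace ℝ (Fin 3)) → ℝ := fun y => curl v y 2 with hg
  set e₂ : (EuclideanSpace ℝ (Fin 3)) := EuclideanSpace.single (2 : Fin 3) (1 : ℝ) with he₂
  have he₂1 : ‖e₂‖ = 1 := by simp [he₂]
  have hc2 : ContDiff ℝ 2 (curl v) := contDiff_curl (n := 2) (by exact_mod_cast hv)
  have hg2 : ContDiff ℝ 2 g := contDiff_apply_coord hc2 2
  have hg1 : ContDiff ℝ 1 g := hg2.of_le (by norm_num)
  have hdg : ∀ x, DifferentiableAt ℝ g x := fun x => (hg1.differentiable one_ne_zero) x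
  have hdω : ∀ x, DifferentiableAt ℝ (curl v) x := fun x => (hc2.differentiable (by norm_num)) x
  set Z : (EuclideanSpace ℝ (Fin 3)) → (EuclideanSpace ℝ (Fin 3)) := fun y => g y • e₂ with hZ
  have hZ1 : ContDiff ℝ 1 Z := hg1.smul contDiff_const
  have hDZ : ∀ x, fderiv ℝ Z x = (fderiv ℝ g x).smulRight e₂ := fun x => by
    rw [hZ]; exact fderiv_smul_const (hdg x) e₂
  -- the transported quantity
  have hinner : ∀ x, ⟪convect v Z x, Z x⟫ = g x * convect v (curl v) x 2 := by
    intro x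
    rw [convect_apply, hDZ x, ContinuousLinearMap.smulRight_apply, fderiv_apply_coord (hdω x) (v x) 2,
      ← convect_apply]
    simp only [hZ, real_inner_smul_left, real_inner_smul_right, real_inner_self_eq_norm_sq, he₂1]
    ring
  -- `L²` memberships of `Z` and `DZ`
  have cg : Continuous g := hg2.continuous
  have cZ : Continuous Z := hZ1.continuous
  have cDZ : Continuous (fderiv ℝ Z) := hZ1.continuous_fderiv one_ne_zero
  have nZ : ∀ x, ‖Z x‖ ≤ ‖κ • iteratedFDeriv ℝ 1 v x‖ := fun x => by
    have h1 : ‖Z x‖ = ‖g x‖ := by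
      simp only [hZ, norm_smul, he₂1, mul_one]
    rw [h1]
    exact norm_le_norm_smul_of_le_mul hκ0 (norm_curl_two_le_mul (hv.of_le (by norm_num)) x)
  have nDZ : ∀ x, ‖fderiv ℝ Z x‖ ≤ ‖κ • iteratedFDeriv ℝ 2 v x‖ := fun x => by
    rw [hDZ x, ContinuousLinearMap.norm_smulRight_apply, he₂1, mul_one]
    exact norm_le_norm_smul_of_le_mul hκ0 (norm_fderiv_curl_two_le_mul (hv.of_le (by norm_num)) x)
  have hZ2 : MemLp Z 2 volume := memLp_two_of_continuous_of_lintegral_lt_top cZ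
    (lintegral_enorm_sq_lt_top_of_norm_le nZ (lintegral_enorm_sq_const_smul_lt_top κ hv1))
  have hDZ2 : MemLp (fun x => fderiv ℝ Z x) 2 volume :=
    memLp_two_of_continuous_of_lintegral_lt_top cDZ
      (lintegral_enorm_sq_lt_top_of_norm_le nDZ (lintegral_enorm_sq_const_smul_lt_top κ hv2))
  have h := integral_inner_convect_transport_eq_zero (hv.of_le (by norm_num)) hdiv hB hZ1 hZ2 hDZ2
  simp_rw [hinner] at h
  exact h

end Transport

/-! ### The production inequality for `‖ω₃‖₂²` -/

section Production

/-- **Production inequality for the third vorticity component** (Lemarié-Rieusset 2016, proof of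
Prop. 11.5, (11.27): `d/dt ½‖ω₃‖₂² = -ν∫|∇ω₃|² - ∫ω₃ u·∇ω₃ + ∫ ω₃ ω·∇u₃`, with
`∫ ω₃ u·∇ω₃ = 0`). Let `v : ℝ³ → ℝ³` be `C³`, bounded with bounded derivative, divergence free,
with `Dv, D²v, D³v ∈ L²`, and let `W : ℝ³ → ℝ³` satisfy
`curl W = νΔω - (v·∇)ω + (ω·∇)v` pointwise, `ω = curl v` (the vorticity equation, as provided by
`IsClassicalNSSolutionOn.curl_timeDerivWithin_eq` for `W = ∂ₜu(t)`, `v = u(t)`, zero force).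
Then `∫ ω₃ (curl W)₃ ≤ -ν ∫ Σᵢ(∂ᵢω₃)² + ∫ |ω₃| |ω| ‖∇v₃‖` (the stretching term
`((ω·∇)v)₃ = ∇v₃ · ω` bounded pointwise by `‖∇v₃‖ |ω|`).
[cite: LemarieRieusset2016, §11.5 Prop. 11.5 proof, (11.27) (PDF p. 355)] -/
theorem integral_curl_two_mul_curl_two_le {ν : ℝ} {v W : (EuclideanSpace ℝ (Fin 3)) → (EuclideanSpace ℝ (Fin 3))} (hv : ContDiff ℝ 3 v)
    (hdiv : VectorCalculus.IsDivFree v) {B : ℝ} (hB : ∀ x, ‖v x‖ ≤ B)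
    {B₁ : ℝ} (hB₁ : ∀ x, ‖fderiv ℝ v x‖ ≤ B₁)
    (hcurlW : ∀ x, curl W x = ν • (Δ (curl v)) x - convect v (curl v) x + convect (curl v) v x)
    (hv1 : ∫⁻ x, ‖iteratedFDeriv ℝ 1 v x‖ₑ ^ 2 < ⊤) (hv2 : ∫⁻ x, ‖iteratedFDeriv ℝ 2 v x‖ₑ ^ 2 < ⊤)
    (hv3 : ∫⁻ x, ‖iteratedFDeriv ℝ 3 v x‖ₑ ^ 2 < ⊤) :
    ∫ x, curl v x 2 * curl W x 2 ≤
      -ν * (∫ x, ∑ i, fderiv ℝ (fun y => curl v y 2) x (EuclideanSpace.basisFun (Fin 3) ℝ i) ^ 2) +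
        ∫ x, |curl v x 2| * ‖curl v x‖ * ‖fderiv ℝ (fun y => v y 2) x‖ := by
  set κ : ℝ := ‖(curlCLM : ((EuclideanSpace ℝ (Fin 3)) →L[ℝ] (EuclideanSpace ℝ (Fin 3))) →L[ℝ] (EuclideanSpace ℝ (Fin 3)))‖ with hκ
  have hκ0 : 0 ≤ κ := norm_nonneg (curlCLM : ((EuclideanSpace ℝ (Fin 3)) →L[ℝ] (EuclideanSpace ℝ (Fin 3))) →L[ℝ] (EuclideanSpace ℝ (Fin 3)))
  set g : (EuclideanSpace ℝ (Fin 3)) → ℝ := fun y => curl v y 2 with hg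
  have hB0 : 0 ≤ B := (norm_nonneg _).trans (hB 0)
  have hB₁0 : 0 ≤ B₁ := (norm_nonneg _).trans (hB₁ 0)
  have hv2' : ContDiff ℝ 2 v := hv.of_le (by norm_num)
  have hv1' : ContDiff ℝ 1 v := hv.of_le (by norm_num)
  have hc2 : ContDiff ℝ 2 (curl v) := contDiff_curl (n := 2) (by exact_mod_cast hv)
  have hc1 : ContDiff ℝ 1 (curl v) := hc2.of_le (by norm_num)
  have hg2 : ContDiff ℝ 2 g := contDiff_apply_coord hc2 2
  have hdv : ∀ x, DifferentiableAt ℝ v x := fun x => (hv1'.differentiable one_ne_zero) x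
  have hdv2 : ∀ x, DifferentiableAt ℝ (fun y => v y 2) x := fun x =>
    ((contDiff_apply_coord hv1' 2).differentiable one_ne_zero) x
  -- continuity
  have cg : Continuous g := hg2.continuous
  have cω : Continuous (curl v) := hc2.continuous
  have cΔω : Continuous (Δ (curl v)) := continuous_laplacian hc2
  have cDω : Continuous (fderiv ℝ (curl v)) := hc2.continuous_fderiv (by norm_num)
  have cDv : Continuous (fderiv ℝ v) := hv1'.continuous_fderiv one_ne_zero
  have cv : Continuous v := hv1'.continuous
  have cDv2 : Continuous (fderiv ℝ (fun y => v y 2)) :=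
    (contDiff_apply_coord hv1' 2).continuous_fderiv one_ne_zero
  have cD1 : Continuous fun x => iteratedFDeriv ℝ 1 v x := hv.continuous_iteratedFDeriv (by norm_num)
  have cD3 : Continuous fun x => iteratedFDeriv ℝ 3 v x := hv.continuous_iteratedFDeriv (by norm_num)
  -- the decomposition of `(curl W)₃`
  have hW2 : ∀ x, curl W x 2 = ν * (Δ (curl v)) x 2 - convect v (curl v) x 2 + convect (curl v) v x 2 := by
    intro x
    have h := congrArg (fun z : (EuclideanSpace ℝ (Fin 3)) => z 2) (hcurlW x)
    simpa only [PiLp.add_apply, PiLp.sub_apply, PiLp.smul_apply, smul_eq_mul] using h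
  -- pointwise bounds
  have n_g : ∀ x, ‖g x‖ ≤ ‖κ • iteratedFDeriv ℝ 1 v x‖ := fun x =>
    norm_le_norm_smul_of_le_mul hκ0 (norm_curl_two_le_mul hv1' x)
  have hDv_eq : ∀ x, ‖fderiv ℝ v x‖ = ‖iteratedFDeriv ℝ 1 v x‖ := fun x => by
    rw [← norm_iteratedFDeriv_fderiv, norm_iteratedFDeriv_zero]
  have n_Δ : ∀ x, ‖(Δ (curl v)) x 2‖ ≤ ‖(3 * κ) • iteratedFDeriv ℝ 3 v x‖ := fun x => by
    refine (PiLp.norm_apply_le ((Δ (curl v)) x) 2).trans ?_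
    refine (norm_laplacian_le_three_mul_norm_iteratedFDeriv_two hc2 x).trans ?_
    rw [norm_smul, Real.norm_of_nonneg (by positivity), mul_assoc]
    exact mul_le_mul_of_nonneg_left (norm_iteratedFDeriv_curl_le (n := 2) (w := v)
      (by exact_mod_cast hv) x) (by norm_num)
  have n_cv : ∀ x, ‖convect v (curl v) x 2‖ ≤ ‖(B * κ) • iteratedFDeriv ℝ 2 v x‖ := fun x => by
    refine (PiLp.norm_apply_le (convect v (curl v) x) 2).trans ?_
    rw [convect_apply, norm_smul, Real.norm_of_nonneg (by positivity), mul_assoc]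
    calc ‖fderiv ℝ (curl v) x (v x)‖ ≤ ‖fderiv ℝ (curl v) x‖ * ‖v x‖ := (fderiv ℝ (curl v) x).le_opNorm _
      _ ≤ (κ * ‖iteratedFDeriv ℝ 2 v x‖) * B :=
          mul_le_mul (norm_fderiv_curl_le_mul hv2' x) (hB x) (norm_nonneg _) (by positivity)
      _ = B * (κ * ‖iteratedFDeriv ℝ 2 v x‖) := by ring
  have n_st : ∀ x, ‖convect (curl v) v x 2‖ ≤ ‖fderiv ℝ (fun y => v y 2) x‖ * ‖curl v x‖ := fun x => by
    rw [convect_apply, ← fderiv_apply_coord (hdv x) (curl v x) 2]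
    exact (fderiv ℝ (fun y => v y 2) x).le_opNorm _
  have n_F : ∀ x, ‖fderiv ℝ (fun y => v y 2) x‖ ≤ B₁ := fun x =>
    (norm_fderiv_apply_coord_le (hdv x) 2).trans (hB₁ x)
  have n_ω' : ∀ x, ‖curl v x‖ ≤ κ * ‖iteratedFDeriv ℝ 1 v x‖ := fun x => norm_curl_le_mul v x
  have n_ω : ∀ x, ‖curl v x‖ ≤ ‖κ • iteratedFDeriv ℝ 1 v x‖ := fun x =>
    norm_le_norm_smul_of_le_mul hκ0 (n_ω' x)
  have n_st' : ∀ x, ‖convect (curl v) v x 2‖ ≤ ‖(B₁ * κ) • iteratedFDeriv ℝ 1 v x‖ := fun x => by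
    refine (n_st x).trans ?_
    rw [norm_smul, Real.norm_of_nonneg (by positivity), mul_assoc]
    exact mul_le_mul (n_F x) (n_ω' x) (norm_nonneg _) hB₁0
  -- finiteness of `L²` norms
  have l2g : ∫⁻ x, ‖g x‖ₑ ^ 2 < ⊤ :=
    lintegral_enorm_sq_lt_top_of_norm_le n_g (lintegral_enorm_sq_const_smul_lt_top κ hv1)
  have l2Δ : ∫⁻ x, ‖(Δ (curl v)) x 2‖ₑ ^ 2 < ⊤ :=
    lintegral_enorm_sq_lt_top_of_norm_le n_Δ (lintegral_enorm_sq_const_smul_lt_top (3 * κ) hv3)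
  have l2cv : ∫⁻ x, ‖convect v (curl v) x 2‖ₑ ^ 2 < ⊤ :=
    lintegral_enorm_sq_lt_top_of_norm_le n_cv (lintegral_enorm_sq_const_smul_lt_top (B * κ) hv2)
  have l2st : ∫⁻ x, ‖convect (curl v) v x 2‖ₑ ^ 2 < ⊤ :=
    lintegral_enorm_sq_lt_top_of_norm_le n_st' (lintegral_enorm_sq_const_smul_lt_top (B₁ * κ) hv1)
  have l2ω : ∫⁻ x, ‖curl v x‖ₑ ^ 2 < ⊤ :=
    lintegral_enorm_sq_lt_top_of_norm_le n_ω (lintegral_enorm_sq_const_smul_lt_top κ hv1)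
  have l2Fω : ∫⁻ x, ‖‖fderiv ℝ (fun y => v y 2) x‖ * ‖curl v x‖‖ₑ ^ 2 < ⊤ := by
    refine lintegral_enorm_sq_lt_top_of_norm_le (b := fun x => (B₁ * κ) • iteratedFDeriv ℝ 1 v x)
      (fun x => ?_) (lintegral_enorm_sq_const_smul_lt_top (B₁ * κ) hv1)
    rw [Real.norm_of_nonneg (mul_nonneg (norm_nonneg _) (norm_nonneg _)), norm_smul,
      Real.norm_of_nonneg (by positivity), mul_assoc]
    exact mul_le_mul (n_F x) (n_ω' x) (norm_nonneg _) hB₁0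
  -- continuity of the pieces
  have cΔ2 : Continuous fun x => (Δ (curl v)) x 2 := (EuclideanSpace.proj (2 : Fin 3)).continuous.comp cΔω
  have ccv2 : Continuous fun x => convect v (curl v) x 2 := by
    have : Continuous fun x => convect v (curl v) x := cDω.clm_apply cv
    exact (EuclideanSpace.proj (2 : Fin 3)).continuous.comp this
  have cst2 : Continuous fun x => convect (curl v) v x 2 := by
    have : Continuous fun x => convect (curl v) v x := cDv.clm_apply cω
    exact (EuclideanSpace.proj (2 : Fin 3)).continuous.comp this
  have cFω : Continuous fun x => ‖fderiv ℝ (fun y => v y 2) x‖ * ‖curl v x‖ := cDv2.norm.mul cω.norm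
  -- integrability of the three products and of the majorant
  have i1 : Integrable (fun x => g x * (Δ (curl v)) x 2) volume :=
    integrable_of_norm_le_mul_of_lintegral_sq (cg.mul cΔ2).aestronglyMeasurable cg cΔ2 l2g l2Δ
      fun x => (norm_mul_le _ _)
  have i2 : Integrable (fun x => g x * convect v (curl v) x 2) volume :=
    integrable_of_norm_le_mul_of_lintegral_sq (cg.mul ccv2).aestronglyMeasurable cg ccv2 l2g l2cv
      fun x => (norm_mul_le _ _)
  have i3 : Integrable (fun x => g x * convect (curl v) v x 2) volume :=
    integrable_of_norm_le_mul_of_lintegral_sq (cg.mul cst2).aestronglyMeasurable cg cst2 l2g l2st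
      fun x => (norm_mul_le _ _)
  have iR : Integrable (fun x => |g x| * ‖curl v x‖ * ‖fderiv ℝ (fun y => v y 2) x‖) volume := by
    have h := integrable_of_norm_le_mul_of_lintegral_sq (φ := fun x => g x * (‖fderiv ℝ (fun y => v y 2) x‖ * ‖curl v x‖))
      (cg.mul cFω).aestronglyMeasurable cg cFω l2g l2Fω fun x => (norm_mul_le _ _)
    refine (h.norm).congr (Eventually.of_forall fun x => ?_)
    simp only [norm_mul, Real.norm_eq_abs, abs_norm]
    ring
  -- the three integrals
  have hsplit : ∫ x, g x * curl W x 2 =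
      ν * (∫ x, g x * (Δ (curl v)) x 2) - (∫ x, g x * convect v (curl v) x 2) +
        ∫ x, g x * convect (curl v) v x 2 := by
    have hfun : (fun x => g x * curl W x 2) = fun x =>
        ν * (g x * (Δ (curl v)) x 2) - g x * convect v (curl v) x 2 + g x * convect (curl v) v x 2 := by
      funext x; rw [hW2 x]; ring
    rw [hfun, integral_add ?_ i3, integral_sub ?_ i2, integral_const_mul]
    · exact i1.const_mul ν
    · exact (i1.const_mul ν).sub i2
  have hvisc := integral_curl_two_mul_laplacian_curl_two hv hv1 hv2 hv3
  have htr := integral_curl_two_mul_convect_curl_two_eq_zero hv hdiv hB hv1 hv2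
  have hst : ∫ x, g x * convect (curl v) v x 2 ≤
      ∫ x, |g x| * ‖curl v x‖ * ‖fderiv ℝ (fun y => v y 2) x‖ := by
    refine integral_mono i3 iR fun x => ?_
    have h1 : g x * convect (curl v) v x 2 ≤ |g x| * ‖convect (curl v) v x 2‖ := by
      rw [Real.norm_eq_abs]; exact (le_abs_self _).trans (le_of_eq (abs_mul _ _))
    refine h1.trans ?_
    rw [mul_assoc]
    refine mul_le_mul_of_nonneg_left ?_ (abs_nonneg _)
    rw [mul_comm]
    exact n_st x
  have hP0 : 0 ≤ ∫ x, ∑ i, fderiv ℝ (fun y => curl v y 2) x (EuclideanSpace.basisFun (Fin 3) ℝ i) ^ 2 :=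
    integral_nonneg fun x => Finset.sum_nonneg fun i _ => sq_nonneg _
  rw [hsplit, hvisc, htr]
  linarith [hst]

end Production

end Literature.Analysis.FluidPDE
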